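import Summits.BirchSwinnertonDyer.BirchSwinnertonDyer.Theses.PlecticLegs
import Literature.NumberTheory.EllipticCurves.LeadingTerm
import Literature.NumberTheory.EllipticCurves.HeegnerPointReflectionHolds

/-!
# BirchSwinnertonDyer / PlecticLegs — support `RankLeOne` (stmt-BirchSwinnertonDyer-17525)

Route `PlecticLegs`, support item `RankLeOne` (rank 9; the hypothesis `hR1` of the deciding
theorem `closes`, used for the curves with `r_an(E) ≤ 1`):
`∀ (W : WeierstrassCurve ℚ) [W.IsElliptic], W.analyticRank ≤ 1 → W.analyticRank = W.mordellWeilRank`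
— the theorem of Gross–Zagier–Kolyvagin over `ℚ` (Gross–Zagier 1986, Thm. I.6.3; Kolyvagin 1990,
Thm. A; with a non-vanishing quadratic twist, Waldspurger 1985 / Bump–Friedberg–Hoffstein 1990 /
Murty–Murty 1991; modularity, Breuil–Conrad–Diamond–Taylor 2001), printed as Darmon, *Rational
Points on Modular Elliptic Curves*, CBMS 101 (2004), Thm. 3.22 (= Thm. 1.14).

The item is, verbatim, the rank half of the tree's named fact **bsd.S17**
`Literature.NumberTheory.EllipticCurves.rank_eq_analyticRank_of_analyticRank_le_one`
(`LeadingTerm.lean`; conclusion `rank = r_an ∧ Ш finite`), which is NOT discharged in the tree: it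
is reduced, sorry-free, to its six printed inputs — modularity in Version `L`
(`existsUnique_isNewformOf`), Waldspurger's and Murty–Murty's quadratic twists
(`waldspurger_exists_heegnerField_twist_ne_zero`, `murtyMurty_exists_heegnerField_twist_simpleZero`),
the Gross–Zagier formula (`gross_zagier`), `K`-rationality of Heegner points
(`exists_isHeegnerPoint`) and Kolyvagin's Theorem A (`kolyvagin`) — by
`rank_eq_analyticRank_of_analyticRank_le_one_of_modularity''` (`HeegnerPointReflectionHolds`),
none of which is discharged either (each is an XL formalisation: modularity lifting, the
Gross–Zagier height computation, Kolyvagin's Euler system).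

This file records the two CONDITIONAL proofs of the item that the tree affords today:

* `plecticLegs_rankLeOne_of_rank_eq_analyticRank_of_analyticRank_le_one` — bsd.S17 `⇒` item
  (drop the finiteness of `Ш`, swap the sides of the equation);
* `plecticLegs_rankLeOne_of_modularity` — the six printed leaves `⇒` item.

So the item closes the moment `rank_eq_analyticRank_of_analyticRank_le_one_holds` lands (or the
six leaves are discharged). Nothing here is unconditional; no definition, no new named fact.
-/

-- D-0017: single-problem summit, so `Summit.BirchSwinnertonDyer.BirchSwinnertonDyer.…` repeats a
-- namespace BY DESIGN.
set_option linter.dupNamespace false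

namespace Summit.BirchSwinnertonDyer.BirchSwinnertonDyer.Theorems

open Literature.NumberTheory.EllipticCurves Literature.NumberTheory.EllipticCurves.ModularForms

/-- **`RankLeOne` from bsd.S17 (Gross–Zagier–Kolyvagin, Darmon 2004 Thm. 3.22).** If every
elliptic `E/ℚ` with `ord_{s=1} L(E, s) ≤ 1` has `rank_ℤ E(ℚ) = ord_{s=1} L(E, s)` and finite `Ш`
(the named fact `rank_eq_analyticRank_of_analyticRank_le_one`, hypothesis `hGZK`), then the route
item `RankLeOne` holds: its conclusion `r_an(E) = rank E(ℚ)` is the first conjunct read backwards.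
CONDITIONAL on `hGZK` (undischarged in the tree). [cite: Darmon2004, Thm. 3.22 (= Thm. 1.14)] -/
theorem plecticLegs_rankLeOne_of_rank_eq_analyticRank_of_analyticRank_le_one
    (hGZK : rank_eq_analyticRank_of_analyticRank_le_one) :
    Summit.BirchSwinnertonDyer.BirchSwinnertonDyer.Theses.PlecticLegs.RankLeOne := by
  intro W _ h
  exact (hGZK W h).1.symm

/-- **`RankLeOne` from the six printed inputs of Darmon's proof of Thm. 3.22** (§3.9), through
the tree's sorry-free assembly `rank_eq_analyticRank_of_analyticRank_le_one_of_modularity''`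
(`HeegnerPointReflectionHolds`: parity from Hecke's functional equation and Atkin–Lehner, proved;
Prop. 3.11, proved; descent of the rank from the Heegner field `K` to `ℚ`, proved):
* `hmod` — modularity in Version `L` (`existsUnique_isNewformOf`; Breuil–Conrad–Diamond–Taylor
  2001, Thm. A);
* `hWa` — for `w(E) = -1`, a Heegner field `K` with `L(E^{(d_K)}, 1) ≠ 0` (Waldspurger 1985);
* `hMM` — for `L(E, 1) ≠ 0`, a Heegner field `K` with `L(E^{(d_K)}, s)` having a simple zero at
  `s = 1` (Murty–Murty 1991, Corollary p. 449; Bump–Friedberg–Hoffstein 1990);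
* `hGZ` — the Gross–Zagier formula (`gross_zagier`; Gross–Zagier 1986, Thm. I.6.3, in the form
  of Cai–Shu–Tian 2014, Thm. 1.1);
* `hHP` — Heegner points are defined over `K` (`exists_isHeegnerPoint`; Gross 1984);
* `hKo` — Kolyvagin's Theorem A (`kolyvagin`; Kolyvagin 1990).
CONDITIONAL on all six (none discharged in the tree). [cite: Darmon2004, Thm. 3.22 and §3.9] -/
theorem plecticLegs_rankLeOne_of_modularity
    (hmod : existsUnique_isNewformOf)
    (hWa : waldspurger_exists_heegnerField_twist_ne_zero)
    (hMM : murtyMurty_exists_heegnerField_twist_simpleZero)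
    (hGZ : ∀ (N : ℕ) [NeZero N] (W : WeierstrassCurve ℚ) (K : Type) [Field K] [NumberField K],
      gross_zagier N W K)
    (hHP : ∀ (W : WeierstrassCurve ℚ) (K : Type) [Field K] [NumberField K],
      exists_isHeegnerPoint W K)
    (hKo : ∀ (N : ℕ) [NeZero N] (W : WeierstrassCurve ℚ) (K : Type) [Field K] [NumberField K],
      kolyvagin N W K) :
    Summit.BirchSwinnertonDyer.BirchSwinnertonDyer.Theses.PlecticLegs.RankLeOne :=
  plecticLegs_rankLeOne_of_rank_eq_analyticRank_of_analyticRank_le_one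
    (rank_eq_analyticRank_of_analyticRank_le_one_of_modularity'' hmod hWa hMM hGZ hHP hKo)

/-! ### Calibration of the debt (attempt c3, 2026-08-17)

Two kernel-checked facts locating the item exactly: it is *equivalent* to the rank half of
bsd.S17 (so nothing weaker than Gross–Zagier–Kolyvagin's rank statement closes it), and it is the
conjunction of the two printed cases `r_an = 0` (Kolyvagin 1990 / Kato 2004) and `r_an = 1`
(Gross–Zagier 1986 + Kolyvagin 1990). (It is also, trivially, a fragment of the summit statement
`BirchSwinnertonDyer` — drop the hypothesis `r_an ≤ 1` — so a refutation of the item would refute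
the summit; that direction is not recorded as a declaration to keep the audit's proof-of-item
class clean.) -/

/-- **`RankLeOne` is literally the rank half of bsd.S17.** The route item is equivalent to
`∀ E/ℚ elliptic, ord_{s=1} L(E,s) ≤ 1 → rank_ℤ E(ℚ) = ord_{s=1} L(E,s)`, i.e. to the first conjunct
of `rank_eq_analyticRank_of_analyticRank_le_one` (Darmon 2004, Thm. 3.22) with the finiteness of
`Ш` dropped; only the orientation of the equation differs. [cite: Darmon2004, Thm. 3.22] -/
theorem plecticLegs_rankLeOne_iff :
    Summit.BirchSwinnertonDyer.BirchSwinnertonDyer.Theses.PlecticLegs.RankLeOne ↔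
      ∀ (W : WeierstrassCurve ℚ) [W.IsElliptic], W.analyticRank ≤ 1 →
        W.mordellWeilRank = W.analyticRank :=
  ⟨fun h W _ hW ↦ (h W hW).symm, fun h W _ hW ↦ (h W hW).symm⟩

/-- **`RankLeOne` splits into its two printed cases.** The item holds iff both
(i) `ord_{s=1} L(E,s) = 0 ⇒ rank_ℤ E(ℚ) = 0` (Kolyvagin 1990 with a non-vanishing quadratic twist,
or Kato 2004, Cor. 14.3) and (ii) `ord_{s=1} L(E,s) = 1 ⇒ rank_ℤ E(ℚ) = 1` (Gross–Zagier 1986,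
Thm. I.6.3 + Kolyvagin 1990) hold for every elliptic `E/ℚ`. Either half alone is an independent
formalisation debt. [cite: Darmon2004, Thm. 3.22 and §3.9] -/
theorem plecticLegs_rankLeOne_iff_cases :
    Summit.BirchSwinnertonDyer.BirchSwinnertonDyer.Theses.PlecticLegs.RankLeOne ↔
      (∀ (W : WeierstrassCurve ℚ) [W.IsElliptic], W.analyticRank = 0 → W.mordellWeilRank = 0) ∧
      (∀ (W : WeierstrassCurve ℚ) [W.IsElliptic], W.analyticRank = 1 → W.mordellWeilRank = 1) := by
  refine ⟨fun h ↦ ⟨fun W _ hW ↦ ?_, fun W _ hW ↦ ?_⟩, fun h W _ hW ↦ ?_⟩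
  · have := h W (by omega)
    omega
  · have := h W (by omega)
    omega
  · rcases Nat.le_one_iff_eq_zero_or_eq_one.mp hW with h0 | h1
    · have := h.1 W h0
      omega
    · have := h.2 W h1
      omega

end Summit.BirchSwinnertonDyer.BirchSwinnertonDyer.Theorems
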